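import Literature.AlgebraicGeometry.Resolution.FiniteSubextensionDescent
import Literature.AlgebraicGeometry.Limits.FiniteTypeModel
import Mathlib.AlgebraicGeometry.Morphisms.Proper
import Mathlib.AlgebraicGeometry.Morphisms.FlatDescent
import Mathlib.CategoryTheory.Limits.Shapes.Pullback.Pasting
import Mathlib.FieldTheory.IntermediateField.Adjoin.Basic
import HarnessLib

/-!
# `WeightedInvariant.DescentPerfectToAll`, line `root-of-a-constant`: descent of the resolution data

Route `ResolutionOfSingularities/WeightedInvariant`, crux `DescentPerfectToAll`
(stmt-ResolutionOfSingularities-0549), stub `stub_descendResolutionData` of the lead's skeleton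
`work/DescentPerfectToAll.lean`, PROVED here (statement verbatim from the ledger registration).

**Statement (Görtz–Wedhorn I, (10.13), Thm. 10.63, Thm. 10.66; EGA IV₃ 8.8.2).** Let `Ω / k` be an
algebraic extension, `f : X → Spec k` separated, locally of finite type and quasi-compact, and
`g : Y → X_Ω = X ×_k Spec Ω` proper. Then there are a subextension `K ⊆ Ω` finite over `k`, a
PROPER `g_K : Y_K → X_K = X ×_k Spec K`, the transition map `t : X_Ω → X_K` (over `X`, and over
`Spec Ω → Spec K`) and `e : Y → Y_K` with `Y = Y_K ×_{X_K} X_Ω` (a cartesian square `e, g, g_K, t`).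

**Proof.** Everything is the limit formalism of the in-tree file
`Literature/AlgebraicGeometry/Resolution/FiniteSubextensionDescent.lean` for the tower of
subextensions `E ⊆ Ω` finite over `k`.
1. `Y → Spec Ω` is separated of finite type, so (`Literature.AlgebraicGeometry.Limits.exists_finiteTypeModel`)
   `Y` is a closed subscheme of `Y₀ ×_{A₀} Spec Ω` for a separated finite type `Y₀ → Spec A₀` over a
   finitely generated subring `A₀ ⊆ Ω`; its finitely many generators are algebraic over `k`, so
   `A₀ ⊆ E₁` for a finite stage `E₁`, and `Y ↪ M ×_{E₁} Spec Ω` with `M = Y₀ ×_{A₀} Spec E₁`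
   separated of finite type over `E₁` (`descendResolutionData_ambient`).
2. `closedSubscheme_descent`: `Y = Y_E ×_{Spec E} Spec Ω` for a closed subscheme
   `Y_E ⊆ M ×_{E₁} Spec E` at a finite stage `E ⊇ E₁` (`descendResolutionData_model`).
3. `morphism_descent`: the `k`-morphism `g ≫ pr₁ : Y → X` factors through the transition
   `r : Y → Y_K = Y_E ×_E Spec K` for a finite stage `K ⊇ E` as `r ≫ u'`; with `Y_K → Spec K` this
   is `g_K : Y_K → X_K`, and `t : X_Ω → X_K` is `exists_transition`.
4. The square `(r, g, g_K, t)` is a commutative square between two base changes of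
   `Spec Ω → Spec K`, hence cartesian (`isPullback_of_isPullback_specTo`).
5. `g_K` is separated and locally of finite type by cancellation (`Y_K → Spec K` is), and
   universally closed by fpqc descent from `g` along the flat surjective affine `t`
   (`descends_of_isPullback`, Mathlib `FlatDescent`); so `g_K` is proper.
-/

-- single-problem summit: the doubled namespace component `ResolutionOfSingularities` is forced
set_option linter.dupNamespace false -- mandated namespace of this single-conjunct summit

noncomputable section

open CategoryTheory CategoryTheory.Limits AlgebraicGeometry
open Literature.AlgebraicGeometry.Resolution

namespace Summit.ResolutionOfSingularities.ResolutionOfSingularities.Theorems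

universe u

variable {k : Type u} [Field k] {Ω : Type u} [Field Ω] [Algebra k Ω] [Algebra.IsAlgebraic k Ω]

/-- **A finite-stage ambient space.** A separated `Ω`-scheme of finite type `Y` is a closed
subscheme of `M ×_{Spec E₁} Spec Ω` for a subextension `E₁ ⊆ Ω` finite over `k` and a separated
`E₁`-scheme `M` of finite type (a finite type model `Y₀ → Spec A₀` over a finitely generated subring
`A₀ ⊆ Ω`, base-changed to the finite stage `E₁ ⊇ A₀` generated by the generators of `A₀`), stated
with a cartesian presentation `M_Ω → M`, `M_Ω → Spec Ω` of `M ×_{E₁} Spec Ω`.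
[cite: GortzWedhorn2020, Thm. 10.63 (p. 327)] -/
theorem descendResolutionData_ambient {Y : Scheme.{u}} (gΩ : Y ⟶ Spec (.of Ω)) [IsSeparated gΩ]
    [LocallyOfFiniteType gΩ] [QuasiCompact gΩ] :
    ∃ (E₁ : IntermediateField k Ω) (_ : FiniteDimensional k E₁) (M : Scheme.{u})
      (m : M ⟶ Spec (.of E₁)) (MΩ : Scheme.{u}) (pΩ : MΩ ⟶ M) (qΩ : MΩ ⟶ Spec (.of Ω))
      (j : Y ⟶ MΩ), IsSeparated m ∧ LocallyOfFiniteType m ∧ QuasiCompact m ∧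
        IsPullback pΩ qΩ m (Spec.map (CommRingCat.ofHom (algebraMap E₁ Ω))) ∧
        IsClosedImmersion j ∧ j ≫ qΩ = gΩ := by
  classical
  obtain ⟨A₀, _, φ, Y₀, p, j, -, hfgA, -, hpsep, hplft, hpqc, hj, hjg⟩ :=
    Literature.AlgebraicGeometry.Limits.exists_finiteTypeModel gΩ
  haveI := hpsep
  haveI := hplft
  haveI := hpqc
  -- generators of `A₀` over `ℤ` and the finite stage `E₁` they generate
  obtain ⟨G, hG⟩ := hfgA.out
  let E₁ : IntermediateField k Ω := IntermediateField.adjoin k (↑(G.image φ) : Set Ω)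
  haveI hfin : FiniteDimensional k E₁ :=
    IntermediateField.finiteDimensional_adjoin fun x _ => Algebra.IsIntegral.isIntegral x
  have hφE : ∀ a : A₀, φ a ∈ E₁ := by
    intro a
    have ha : a ∈ Algebra.adjoin ℤ (G : Set A₀) := by rw [hG]; exact Algebra.mem_top
    rw [Algebra.adjoin_int, mem_subalgebraOfSubring] at ha
    have hφa : φ a ∈ (Subring.closure (G : Set A₀)).map φ := Subring.mem_map.mpr ⟨a, ha, rfl⟩
    rw [RingHom.map_closure] at hφa
    refine (Subring.closure_le.mpr ?_ : Subring.closure (φ '' (G : Set A₀)) ≤ E₁.toSubring) hφa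
    rintro _ ⟨x, hx, rfl⟩
    exact IntermediateField.subset_adjoin k _ (Finset.mem_coe.2 (Finset.mem_image_of_mem φ hx))
  let φ₁ : A₀ →+* E₁ := φ.codRestrict E₁ hφE
  have hφ₁ : (algebraMap E₁ Ω).comp φ₁ = φ := RingHom.ext fun _ => rfl
  have hSpec : Spec.map (CommRingCat.ofHom (algebraMap E₁ Ω)) ≫ Spec.map (CommRingCat.ofHom φ₁) =
      Spec.map (CommRingCat.ofHom φ) := by
    rw [← Spec.map_comp, ← CommRingCat.ofHom_comp, hφ₁]
  -- the ambient `M = Y₀ ×_{A₀} Spec E₁` and the presentation of `Y₀ ×_{A₀} Spec Ω` over it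
  have w : pullback.fst p (Spec.map (CommRingCat.ofHom φ)) ≫ p =
      (pullback.snd p (Spec.map (CommRingCat.ofHom φ)) ≫
        Spec.map (CommRingCat.ofHom (algebraMap E₁ Ω))) ≫ Spec.map (CommRingCat.ofHom φ₁) := by
    rw [Category.assoc, hSpec]
    exact pullback.condition
  let pΩ : pullback p (Spec.map (CommRingCat.ofHom φ)) ⟶
      pullback p (Spec.map (CommRingCat.ofHom φ₁)) :=
    pullback.lift (pullback.fst _ _)
      (pullback.snd _ _ ≫ Spec.map (CommRingCat.ofHom (algebraMap E₁ Ω))) w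
  have h1 : pΩ ≫ pullback.fst p (Spec.map (CommRingCat.ofHom φ₁)) =
      pullback.fst p (Spec.map (CommRingCat.ofHom φ)) :=
    pullback.lift_fst _ _ _
  have h2 : pΩ ≫ pullback.snd p (Spec.map (CommRingCat.ofHom φ₁)) =
      pullback.snd p (Spec.map (CommRingCat.ofHom φ)) ≫
        Spec.map (CommRingCat.ofHom (algebraMap E₁ Ω)) :=
    pullback.lift_snd _ _ _
  have hP : IsPullback pΩ (pullback.snd p (Spec.map (CommRingCat.ofHom φ)))
      (pullback.snd p (Spec.map (CommRingCat.ofHom φ₁)))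
      (Spec.map (CommRingCat.ofHom (algebraMap E₁ Ω))) := by
    refine IsPullback.of_right (h₁₂ := pullback.fst p (Spec.map (CommRingCat.ofHom φ₁)))
      (v₁₃ := p) (h₂₂ := Spec.map (CommRingCat.ofHom φ₁)) ?_ h2 (IsPullback.of_hasPullback _ _)
    rw [h1, hSpec]
    exact IsPullback.of_hasPullback _ _
  exact ⟨E₁, hfin, _, pullback.snd p (Spec.map (CommRingCat.ofHom φ₁)), _, pΩ, _, j,
    inferInstance, inferInstance, inferInstance, hP, hj, hjg⟩

/-- **A finite-stage model** (Görtz–Wedhorn I, Thm. 10.66 with Prop. 10.75 (1); EGA IV₃ 8.8.2 (ii)).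
A separated `Ω`-scheme of finite type `Y`, `Ω / k` algebraic, is the base change
`Y = Y_E ×_{Spec E} Spec Ω` of a separated scheme of finite type `Y_E → Spec E` over a
subextension `E ⊆ Ω` finite over `k` (the closed subscheme `Y ⊆ M ×_{E₁} Spec Ω` of
`descendResolutionData_ambient` comes from a finite stage by `closedSubscheme_descent`).
[cite: GortzWedhorn2020, Thm. 10.66 with Prop. 10.75 (1), pp. 328–333] -/
theorem descendResolutionData_model {Y : Scheme.{u}} (gΩ : Y ⟶ Spec (.of Ω)) [IsSeparated gΩ]
    [LocallyOfFiniteType gΩ] [QuasiCompact gΩ] :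
    ∃ (E : IntermediateField k Ω) (_ : FiniteDimensional k E) (YE : Scheme.{u})
      (y : YE ⟶ Spec (.of E)) (a : Y ⟶ YE), IsSeparated y ∧ LocallyOfFiniteType y ∧
        QuasiCompact y ∧ IsPullback a gΩ y (Spec.map (CommRingCat.ofHom (algebraMap E Ω))) := by
  obtain ⟨E₁, hfin₁, M, m, MΩ, pΩ, qΩ, j, hm₁, hm₂, hm₃, hP, hj, hjg⟩ :=
    descendResolutionData_ambient (k := k) gΩ
  haveI := hfin₁
  haveI := hm₁
  haveI := hm₂
  haveI := hm₃
  haveI := hj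
  obtain ⟨E, hE, hfin, H⟩ := closedSubscheme_descent E₁ m hP j.ker
  haveI := hfin
  -- the chosen stage `M_E = M ×_{E₁} Spec E` and the transition `r : M_Ω → M_E`
  let r : MΩ ⟶ pullback m (Spec.map (CommRingCat.ofHom (AlgHom.toRingHom
      (IntermediateField.inclusion hE)))) :=
    pullback.lift pΩ (qΩ ≫ Spec.map (CommRingCat.ofHom (algebraMap E Ω)))
      (by rw [Category.assoc, specTo_comp_specLE]; exact hP.w)
  have hr₁ : r ≫ pullback.fst m (Spec.map (CommRingCat.ofHom (AlgHom.toRingHom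
      (IntermediateField.inclusion hE)))) = pΩ :=
    pullback.lift_fst _ _ _
  have hr₂ : r ≫ pullback.snd m (Spec.map (CommRingCat.ofHom (AlgHom.toRingHom
      (IntermediateField.inclusion hE)))) = qΩ ≫ Spec.map (CommRingCat.ofHom (algebraMap E Ω)) :=
    pullback.lift_snd _ _ _
  obtain ⟨J, hJ⟩ := H _ (pullback.fst _ _) (pullback.snd _ _) (IsPullback.of_hasPullback _ _) r
    hr₁ hr₂
  -- the presentation `M_Ω = M_E ×_{Spec E} Spec Ω`
  have hrΩ : IsPullback r qΩ (pullback.snd m (Spec.map (CommRingCat.ofHom (AlgHom.toRingHom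
      (IntermediateField.inclusion hE))))) (Spec.map (CommRingCat.ofHom (algebraMap E Ω))) := by
    refine IsPullback.of_right (h₁₂ := pullback.fst m (Spec.map (CommRingCat.ofHom
      (AlgHom.toRingHom (IntermediateField.inclusion hE))))) (v₁₃ := m) (h₂₂ := Spec.map
      (CommRingCat.ofHom (AlgHom.toRingHom (IntermediateField.inclusion hE)))) ?_ hr₂
      (IsPullback.of_hasPullback _ _)
    rw [hr₁, specTo_comp_specLE]
    exact hP
  -- the closed model `Y_E = V(J)`, `Y = Y_E ×_{M_E} M_Ω = Y_E ×_{Spec E} Spec Ω`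
  obtain ⟨a, -, hsq⟩ := exists_isPullback_subscheme r j J hJ
  refine ⟨E, hfin, J.subscheme, J.subschemeι ≫ pullback.snd m (Spec.map (CommRingCat.ofHom
    (AlgHom.toRingHom (IntermediateField.inclusion hE)))), a, inferInstance, inferInstance,
    inferInstance, ?_⟩
  have h := isPullback_specTo_of_isPullback hrΩ hsq
  rwa [hjg] at h

/-- **Descent of a proper morphism to `X_Ω` to a finite stage** (universe-polymorphic form of
`stub_descendResolutionData`): for `Ω / k` algebraic, `f : X → Spec k` separated of finite type and
`g : Y → X_Ω` proper, there are a finite stage `K ⊆ Ω`, a proper `g_K : Y_K → X_K`, the transition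
`t : X_Ω → X_K` and `e : Y → Y_K` forming a cartesian square (`morphism_descent` applied to
`g ≫ pr₁ : Y → X` on the finite-stage model of `descendResolutionData_model`; properness of `g_K`
by cancellation and fpqc descent of universal closedness along `t`).
[cite: GortzWedhorn2020, Thm. 10.63, p. 328] -/
theorem descendResolutionData_exists {X : Scheme.{u}} (f : X ⟶ Spec (.of k)) [IsSeparated f]
    [LocallyOfFiniteType f] [QuasiCompact f] {Y : Scheme.{u}}
    (g : Y ⟶ pullback f (Spec.map (CommRingCat.ofHom (algebraMap k Ω)))) [IsProper g] :
    ∃ (K : IntermediateField k Ω) (_ : FiniteDimensional k K) (YK : Scheme.{u})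
      (gK : YK ⟶ pullback f (Spec.map (CommRingCat.ofHom (algebraMap k K)))) (e : Y ⟶ YK)
      (t : pullback f (Spec.map (CommRingCat.ofHom (algebraMap k Ω))) ⟶
        pullback f (Spec.map (CommRingCat.ofHom (algebraMap k K)))),
      IsProper gK ∧
      t ≫ pullback.fst f (Spec.map (CommRingCat.ofHom (algebraMap k K))) =
        pullback.fst f (Spec.map (CommRingCat.ofHom (algebraMap k Ω))) ∧
      t ≫ pullback.snd f (Spec.map (CommRingCat.ofHom (algebraMap k K))) =
        pullback.snd f (Spec.map (CommRingCat.ofHom (algebraMap k Ω))) ≫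
          Spec.map (CommRingCat.ofHom (algebraMap K Ω)) ∧
      IsPullback e g gK t := by
  -- Steps 1–2: a separated finite-type model `y : Y_E → Spec E` of `Y → Spec Ω`
  obtain ⟨E, hfinE, YE, y, a, hy₁, hy₂, hy₃, hY⟩ := descendResolutionData_model (k := k)
    (g ≫ pullback.snd f (Spec.map (CommRingCat.ofHom (algebraMap k Ω))))
  haveI := hfinE
  haveI := hy₁
  haveI := hy₂
  haveI := hy₃
  -- Step 3: descend the `k`-morphism `g ≫ pr₁ : Y → X`
  have hu : (g ≫ pullback.fst f (Spec.map (CommRingCat.ofHom (algebraMap k Ω)))) ≫ f =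
      (g ≫ pullback.snd f (Spec.map (CommRingCat.ofHom (algebraMap k Ω)))) ≫
        Spec.map (CommRingCat.ofHom (algebraMap k Ω)) := by
    simp only [Category.assoc, pullback.condition]
  obtain ⟨K, hEK, hfinK, H⟩ := morphism_descent E y hY f _ hu
  haveI := hfinK
  -- the level-`K` model `Y_K = Y_E ×_{Spec E} Spec K` and the transition `r : Y → Y_K`
  let r : Y ⟶ pullback y (Spec.map (CommRingCat.ofHom (AlgHom.toRingHom
      (IntermediateField.inclusion hEK)))) :=
    pullback.lift a ((g ≫ pullback.snd f (Spec.map (CommRingCat.ofHom (algebraMap k Ω)))) ≫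
      Spec.map (CommRingCat.ofHom (algebraMap K Ω)))
      (by rw [Category.assoc, specTo_comp_specLE]; exact hY.w)
  have hr₁ : r ≫ pullback.fst y (Spec.map (CommRingCat.ofHom (AlgHom.toRingHom
      (IntermediateField.inclusion hEK)))) = a :=
    pullback.lift_fst _ _ _
  have hr₂ : r ≫ pullback.snd y (Spec.map (CommRingCat.ofHom (AlgHom.toRingHom
      (IntermediateField.inclusion hEK)))) =
      (g ≫ pullback.snd f (Spec.map (CommRingCat.ofHom (algebraMap k Ω)))) ≫
        Spec.map (CommRingCat.ofHom (algebraMap K Ω)) :=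
    pullback.lift_snd _ _ _
  obtain ⟨u', hu'⟩ := H _ (pullback.fst _ _) (pullback.snd _ _) (IsPullback.of_hasPullback _ _) r
    hr₁ hr₂
  -- `Y = Y_K ×_{Spec K} Spec Ω`
  have hrK : IsPullback r (g ≫ pullback.snd f (Spec.map (CommRingCat.ofHom (algebraMap k Ω))))
      (pullback.snd y (Spec.map (CommRingCat.ofHom (AlgHom.toRingHom
        (IntermediateField.inclusion hEK))))) (Spec.map (CommRingCat.ofHom (algebraMap K Ω))) := by
    refine IsPullback.of_right (h₁₂ := pullback.fst y (Spec.map (CommRingCat.ofHom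
      (AlgHom.toRingHom (IntermediateField.inclusion hEK))))) (v₁₃ := y) (h₂₂ := Spec.map
      (CommRingCat.ofHom (AlgHom.toRingHom (IntermediateField.inclusion hEK)))) ?_ hr₂
      (IsPullback.of_hasPullback _ _)
    rw [hr₁, specTo_comp_specLE]
    exact hY
  -- `u'` is a `k`-morphism (cancel the epimorphism `r`), whence `g_K : Y_K → X_K`
  haveI : Epi r := epi_of_isPullback hrK
  have hu'f : u' ≫ f = pullback.snd y (Spec.map (CommRingCat.ofHom (AlgHom.toRingHom
      (IntermediateField.inclusion hEK)))) ≫ Spec.map (CommRingCat.ofHom (algebraMap k K)) := by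
    rw [← cancel_epi r, reassoc_of% hu', pullback.condition, reassoc_of% hr₂, specTo_comp_specOf]
  let gK : pullback y (Spec.map (CommRingCat.ofHom (AlgHom.toRingHom
      (IntermediateField.inclusion hEK)))) ⟶
      pullback f (Spec.map (CommRingCat.ofHom (algebraMap k K))) :=
    pullback.lift u' _ hu'f
  have hgK₁ : gK ≫ pullback.fst f (Spec.map (CommRingCat.ofHom (algebraMap k K))) = u' :=
    pullback.lift_fst _ _ _
  have hgK₂ : gK ≫ pullback.snd f (Spec.map (CommRingCat.ofHom (algebraMap k K))) =
      pullback.snd y (Spec.map (CommRingCat.ofHom (AlgHom.toRingHom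
        (IntermediateField.inclusion hEK)))) :=
    pullback.lift_snd _ _ _
  -- Step 4: the transition `t : X_Ω → X_K` and the cartesian square
  obtain ⟨t, ht₁, ht₂, ht⟩ := exists_transition f K
  have hcomm : g ≫ t = r ≫ gK := by
    apply pullback.hom_ext
    · rw [Category.assoc, ht₁, Category.assoc, hgK₁, hu']
    · simp only [Category.assoc, ht₂, hgK₂, hr₂]
  have sq : IsPullback g r t gK := isPullback_of_isPullback_specTo hrK ht g gK hcomm rfl hgK₂
  -- Step 5: `g_K` is proper
  haveI : UniversallyClosed gK :=
    descends_of_isPullback (P := @UniversallyClosed) ht sq inferInstance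
  haveI : IsSeparated (gK ≫ pullback.snd f (Spec.map (CommRingCat.ofHom (algebraMap k K)))) := by
    rw [hgK₂]; infer_instance
  haveI : LocallyOfFiniteType (gK ≫ pullback.snd f (Spec.map (CommRingCat.ofHom
      (algebraMap k K)))) := by
    rw [hgK₂]; infer_instance
  haveI : IsSeparated gK :=
    IsSeparated.of_comp gK (pullback.snd f (Spec.map (CommRingCat.ofHom (algebraMap k K))))
  haveI : LocallyOfFiniteType gK :=
    locallyOfFiniteType_of_comp gK (pullback.snd f (Spec.map (CommRingCat.ofHom (algebraMap k K))))
  have hproper : IsProper gK := (isProper_iff gK).mpr ⟨inferInstance, inferInstance, inferInstance⟩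
  exact ⟨K, hfinK, _, gK, r, t, hproper, ht₁, ht₂, sq.flip⟩

/-- STUB `stub_descendResolutionData` (limit descent of the data, Görtz–Wedhorn I, Thm. 10.63 /
Thm. 10.66; EGA IV₃ 8.8.2): for an algebraic extension `Ω / k` and a separated `k`-scheme of
finite type `X`, every proper `g : Y → X ⊗_k Ω` is the base change, along the transition map
`t : X ⊗_k Ω → X ⊗_k K` (over `X` and over `Spec Ω → Spec K`), of a PROPER morphism
`g_K : Y_K → X ⊗_k K` over a subextension `K ⊆ Ω` finite over `k`.
[cite: GortzWedhorn2020, Thm. 10.63, p. 328] -/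
theorem stub_descendResolutionData : ∀ (k Ω : Type) [Field k] [Field Ω] [Algebra k Ω] [Algebra.IsAlgebraic k Ω] (X : Scheme.{0}) (f : X ⟶ Spec (.of k)), IsSeparated f → LocallyOfFiniteType f → QuasiCompact f → ∀ (Y : Scheme.{0}) (g : Y ⟶ pullback f (Spec.map (CommRingCat.ofHom (algebraMap k Ω)))), IsProper g → ∃ (K : IntermediateField k Ω) (_ : FiniteDimensional k K) (YK : Scheme.{0}) (gK : YK ⟶ pullback f (Spec.map (CommRingCat.ofHom (algebraMap k K)))) (e : Y ⟶ YK) (t : pullback f (Spec.map (CommRingCat.ofHom (algebraMap k Ω))) ⟶ pullback f (Spec.map (CommRingCat.ofHom (algebraMap k K)))), IsProper gK ∧ t ≫ pullback.fst f (Spec.map (CommRingCat.ofHom (algebraMap k K))) = pullback.fst f (Spec.map (CommRingCat.ofHom (algebraMap k Ω))) ∧ t ≫ pullback.snd f (Spec.map (CommRingCat.ofHom (algebraMap k K))) = pullback.snd f (Spec.map (CommRingCat.ofHom (algebraMap k Ω))) ≫ Spec.map (CommRingCat.ofHom (algebraMap K Ω)) ∧ IsPullback e g gK t := by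
  intro k Ω _ _ _ _ X f hsep hlft hqc Y g hg
  haveI := hsep
  haveI := hlft
  haveI := hqc
  haveI := hg
  exact descendResolutionData_exists f g

end Summit.ResolutionOfSingularities.ResolutionOfSingularities.Theorems

end
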